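/-
Copyright (c) 2026 the pub-hodgecm-mathlib formalisation cell (harness21).  Prover seat hodgecm-mathlib-R90-C133-p01 (g3), R90-TF section S5
(Rogawski Ch. 13.3); deal (H33) of the S5 dealer R90-C133-plan (g3) 2026-09-05T03:41:02Z: brick (N2) of the Literature road to S5-C's socket
`stub_R90_S5_excPS_notUnitarizable` (census (H29) `CENSUS-D-REMAINDER.md` 990a3cc665ef2629 §4 R6-2, verdict (H31)).
-/
import Literature.NumberTheory.Automorphic.JacquetRayHeckeOperator        -- ★ R1 `Representation.heckeRay` (`T_a v = e_K (ρ a v)`), `apply_avgProj_eq_of_forall`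
import Literature.NumberTheory.Automorphic.SmoothCharacterUnitaryBound     -- ★ `Representation.IsUnitarizable.exists_core_invariant` (the invariant form as an inner-product core)
import Literature.NumberTheory.Automorphic.JacquetRayExponents           -- (ED. 2) ★ R2 `heckeRayEnd`, `HasJacquetExponent`, `exists_hasEigenvalue_heckeRayEnd_of_hasJacquetExponent`
import HarnessLib

/-!
# R90-TF · S5 — `R90S5UnitarizableRayEigenvalueBound`: UNITARIZABLE ⇒ every Hecke-ray eigenvalue on `V^K` has modulus `≤ 1`
# (the unitary twin of ★ `RayCoefficient.norm_sq_lt_of_eigenvector`, Casselman 1995 Thm. 4.4.6 «⇒» for square-integrable `π`)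

Cell `hodgecm-mathlib`, crux H413 (`stmt-HodgeConjecture-24833`), route of record `HCCMUnconditional`; programme R90-TF (HUMAN RULING «R90-TF SLAB —
MAX PUSH»), section S5 (Rogawski Ch. 13.3, base `R90-C133`); seat R90-C133-p01 (g3), deal (H33).  THEOREMS ONLY: no definition, no instance, no
notation, no named fact, no `sorry`; imports ★ Literature only; `--supports stmt-HodgeConjecture-24833` (helper).  Namespace `…R90.S5` (brief §3 rule 4).

WHY.  S5-C's socket `stub_R90_S5_excPS_notUnitarizable : ExcPSNotUnitarizableLetter` (`Cruxes/H413/Lines/R90_S5_HSideExportC.lean` :486; [Rogawski1990,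
§13.1 p. 199 ¶3 «no twist of `ρ` is unitary», Thm. 13.1.1 (2)]) says: no constituent of the excluded principal series `i_H((‖·‖_E^{±1}·μ⁻¹, χ₂)) ⊗ (χ₂ ∘ det)`
of `H_v = U(Φ₂)_v × U(Φ₁)_v` is unitarizable.  The printed argument is «`|χ₁| = δ_B^{±1}` is outside the complementary strip, so a constituent carries a
Jacquet exponent whose matrix coefficients GROW along the contracting ray; a unitary representation has BOUNDED coefficients».  This file is the
second half in the tree's rank-one «ray» currency (★ R1 `JacquetRayHeckeOperator`, ★ R2 `JacquetRayExponents`, ★ R4 `SquareIntegrableRayCoefficientDecay`):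

* §1 **`norm_le_one_of_isUnitarizable_of_eigenvector`** — for a UNITARIZABLE `ρ` (★ `Representation.IsUnitarizable`: an invariant positive-definite
  Hermitian form), `K ≤ G` any subgroup, `v ∈ V^K`, `v ≠ 0`, and a map `T : V → V` through which the `K`-invariant linear forms read the step
  along `a` (`φ (ρ a v) = φ (T v)` — R1's shape), every eigenvalue `T v = λ v` has **`‖λ‖ ≤ 1`**.  Proof: the invariant form is an inner product
  (★ `IsUnitarizable.exists_core_invariant`); `φ := ⟪v, ·⟫` is `K`-invariant because `v ∈ V^K`; `λ‖v‖² = ⟪v, T v⟫ = ⟪v, ρ(a) v⟫`, and Cauchy–Schwarz with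
  `‖ρ(a) v‖ = ‖v‖`.  ONE step suffices (the square-integrable twin needs all powers `aᵐ` only to sum a geometric series); no measure, no admissibility,
  no topology.  `…_iterate`: the same with ★ R4's hypothesis shape `∀ m, φ (ρ (a ^ m) v) = φ (T^[m] v)` VERBATIM (instantiated at `m = 1`).
* §2 **`norm_heckeRay_eigenvalue_le_one`** — the consumer form over ★ R1: for smooth unitarizable `ρ` and compact `K`, every eigenvalue of the Hecke
  ray operator `T_a = e_K ∘ ρ(a)` (★ `Representation.heckeRay`; `e_K` = ★ `avgProj`, the NORMALISED average, so `T_a|_{V^K} = e_K ρ(a) e_K` is the compression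
  of a unitary operator) on a non-zero `K`-fixed vector has modulus `≤ 1`; `…_of_mk_eq`: the class-level reading for a unitarizable class `c = [r]`
  (★ `IrrClass.IsUnitarizable.rep`, `r.isSmooth`).
NORMALISATION NOTE for the consumer (N3): with ★ R2's dictionary («`T_a`-eigenvalue `λ` on `V^K` ↔ Jacquet exponent», normalised exponent
`χ′(a) = λ · δ_P(a)^{-1/2}` as read by ★ `RayCoefficient.norm_mul_lt_one_of_norm_sq_lt`) §2 says `‖χ′(a)‖ ≤ δ_P(a)^{-1/2}` for every exponent carried by a
`K`-fixed ray eigenvector — the unitary analogue of Casselman's square-integrable bound `‖χ′(a)‖ < 1`; no `δ_P`-statement is made here.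
HONEST LABEL: this file pays no socket by itself (first brick of C :486's Literature road (N1)(N2)(N3)); HC_CM is proved only modulo the 7 printed
citations (2 remaining named inputs: hLiu418 = `stmt-HodgeConjecture-24832`, h413 = `stmt-HodgeConjecture-24833`) until rung 0 closes.

## References
* [Casselman1995] W. Casselman, *Introduction to the theory of admissible representations of `p`-adic reductive groups* (draft 1 May 1995), §2.1,
  §4.1, Thm. 4.4.6 (the square-integrable twin); §2.5 (unitary ⇒ bounded matrix coefficients).
* [BushnellHenniart2006] C. J. Bushnell, G. Henniart, *The Local Langlands Conjecture for GL(2)*, Grundlehren 335 (2006), §11.1 (unitarizable smooth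
  representations; invariance of the form).
* [Rogawski1990] J. D. Rogawski, *Automorphic Representations of Unitary Groups in Three Variables*, Ann. of Math. Stud. 123 (1990), §13.1 p. 199 ¶3,
  Thm. 13.1.1 (2) p. 198; §12.1 p. 171 (the consumer statement).
-/

set_option autoImplicit false
-- the mandated namespace repeats the single-problem summit's segment (`HodgeConjecture.HodgeConjecture`)
set_option linter.dupNamespace false

open Literature.NumberTheory.Automorphic
open scoped InnerProductSpace ComplexConjugate

namespace Summit.HodgeConjecture.HodgeConjecture.R90.S5

/-! ## §1 The one-step Cauchy–Schwarz bound (no topology, no measure, no admissibility) -/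

section Core

variable {G V : Type*} [Group G] [AddCommGroup V] [Module ℂ V] {ρ : Representation ℂ G V}

/-- **UNITARIZABLE ⇒ RAY EIGENVALUES HAVE MODULUS `≤ 1` (one step).**  Let `ρ` be unitarizable, `K ≤ G`, `v ∈ V^K` non-zero, and let `T : V → V` be
read by every `K`-invariant linear form as the step along `a` on `v` (`φ (ρ a v) = φ (T v)` — for ★ R1's `T = T_a = e_K ∘ ρ(a)` this is
`φ ∘ e_K = φ`).  If `T v = λ v` then `‖λ‖ ≤ 1`: with the invariant inner product, `⟪v, ·⟫` is `K`-invariant, `λ ‖v‖² = ⟪v, ρ(a) v⟫`, and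
`‖⟪v, ρ(a) v⟫‖ ≤ ‖v‖ ‖ρ(a) v‖ = ‖v‖²`. [cite: Casselman1995, §2.5, §4.1] [cite: BushnellHenniart2006, §11.1] -/
theorem norm_le_one_of_isUnitarizable_of_eigenvector (hu : ρ.IsUnitarizable) {K : Subgroup G} {T : V → V} {a : G} {v : V}
    (hv : v ∈ ρ.fixedPoints K) (hv0 : v ≠ 0)
    (hray : ∀ φ : Module.Dual ℂ V, (∀ κ ∈ K, ∀ x : V, φ (ρ κ x) = φ x) → φ (ρ a v) = φ (T v))
    {lam : ℂ} (hTv : T v = lam • v) : ‖lam‖ ≤ 1 := by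
  obtain ⟨cd, hcd⟩ := hu.exists_core_invariant
  letI : NormedAddCommGroup V := @InnerProductSpace.Core.toNormedAddCommGroup ℂ V _ _ _ cd
  letI : InnerProductSpace ℂ V := InnerProductSpace.ofCore cd.toCore
  -- invariance of the inner product and of the norm
  have hinv : ∀ (g : G) (x y : V), ⟪ρ g x, ρ g y⟫_ℂ = ⟪x, y⟫_ℂ := fun g x y => hcd g x y
  have hnorm : ∀ (g : G) (x : V), ‖ρ g x‖ = ‖x‖ := fun g x => by
    have h2 : ‖ρ g x‖ ^ 2 = ‖x‖ ^ 2 := by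
      rw [@norm_sq_eq_re_inner ℂ, @norm_sq_eq_re_inner ℂ, hinv]
    exact (sq_eq_sq₀ (norm_nonneg _) (norm_nonneg _)).1 h2
  -- `φ := ⟪v, ·⟫` is `K`-invariant since `v ∈ V^K`
  have hvK : ∀ κ ∈ K, ρ κ v = v := (ρ.mem_fixedPoints K v).1 hv
  have hφK : ∀ κ ∈ K, ∀ x : V, innerₛₗ ℂ v (ρ κ x) = innerₛₗ ℂ v x := fun κ hκ x => by
    rw [innerₛₗ_apply_apply, innerₛₗ_apply_apply]
    conv_lhs => rw [← hvK κ hκ]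
    exact hinv κ v x
  -- `⟪v, ρ a v⟫ = λ ‖v‖²`
  have hstep : ⟪v, ρ a v⟫_ℂ = lam * ⟪v, v⟫_ℂ := by
    have h := hray (innerₛₗ ℂ v) hφK
    rw [innerₛₗ_apply_apply, innerₛₗ_apply_apply, hTv, inner_smul_right] at h
    exact h
  -- Cauchy–Schwarz
  have hvpos : 0 < ‖v‖ := norm_pos_iff.2 hv0
  have hvv : ‖⟪v, v⟫_ℂ‖ = ‖v‖ ^ 2 := by
    rw [inner_self_eq_norm_sq_to_K]
    simp only [norm_pow, RCLike.norm_ofReal, abs_norm]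
  have hcs : ‖lam‖ * ‖v‖ ^ 2 ≤ ‖v‖ ^ 2 := by
    calc ‖lam‖ * ‖v‖ ^ 2 = ‖lam * ⟪v, v⟫_ℂ‖ := by rw [norm_mul, hvv]
      _ = ‖⟪v, ρ a v⟫_ℂ‖ := by rw [hstep]
      _ ≤ ‖v‖ * ‖ρ a v‖ := norm_inner_le_norm _ _
      _ = ‖v‖ ^ 2 := by rw [hnorm, sq]
  have hv2 : 0 < ‖v‖ ^ 2 := pow_pos hvpos 2
  calc ‖lam‖ = ‖lam‖ * ‖v‖ ^ 2 / ‖v‖ ^ 2 := by rw [mul_div_assoc, div_self hv2.ne', mul_one]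
    _ ≤ ‖v‖ ^ 2 / ‖v‖ ^ 2 := div_le_div_of_nonneg_right hcs hv2.le
    _ = 1 := div_self hv2.ne'

/-- **The same, hypotheses in ★ R4's shape** (`RayCoefficient.norm_sq_lt_of_eigenvector`): `T` read along ALL powers, `φ (ρ (a ^ m) v) = φ (T^[m] v)` for every
`K`-invariant `φ` — instantiated at `m = 1`.  (Homogeneity of `T` is not needed for the bound.) [cite: Casselman1995, §4.1, Thm. 4.4.6] -/
theorem norm_le_one_of_isUnitarizable_of_eigenvector_iterate (hu : ρ.IsUnitarizable) {K : Subgroup G} {T : V → V} {a : G} {v : V}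
    (hv : v ∈ ρ.fixedPoints K) (hv0 : v ≠ 0)
    (hray : ∀ φ : Module.Dual ℂ V, (∀ κ ∈ K, ∀ x : V, φ (ρ κ x) = φ x) → ∀ m : ℕ, φ (ρ (a ^ m) v) = φ (T^[m] v))
    {lam : ℂ} (hTv : T v = lam • v) : ‖lam‖ ≤ 1 :=
  norm_le_one_of_isUnitarizable_of_eigenvector hu hv hv0
    (fun φ hφ => by simpa only [pow_one, Function.iterate_one] using hray φ hφ 1) hTv

/-- **All powers**: under the one-step hypotheses, `‖λ‖ ^ m ≤ 1` for every `m` (the form in which a geometric ray coefficient `λᵐ φ(v)` is bounded).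
[cite: Casselman1995, §4.1] -/
theorem norm_pow_le_one_of_isUnitarizable_of_eigenvector (hu : ρ.IsUnitarizable) {K : Subgroup G} {T : V → V} {a : G} {v : V}
    (hv : v ∈ ρ.fixedPoints K) (hv0 : v ≠ 0)
    (hray : ∀ φ : Module.Dual ℂ V, (∀ κ ∈ K, ∀ x : V, φ (ρ κ x) = φ x) → φ (ρ a v) = φ (T v))
    {lam : ℂ} (hTv : T v = lam • v) (m : ℕ) : ‖lam‖ ^ m ≤ 1 :=
  pow_le_one₀ (norm_nonneg _) (norm_le_one_of_isUnitarizable_of_eigenvector hu hv hv0 hray hTv)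

end Core

/-! ## §2 The consumer form over ★ R1's Hecke ray operator `T_a = e_K ∘ ρ(a)` -/

section HeckeRay

variable {G V : Type*} [Group G] [TopologicalSpace G] [IsTopologicalGroup G] [AddCommGroup V] [Module ℂ V]
  {ρ : Representation ℂ G V}

/-- **UNITARIZABLE ⇒ EVERY HECKE-RAY EIGENVALUE ON `V^K` HAS MODULUS `≤ 1`.**  For a smooth unitarizable `ρ`, a compact subgroup `K` and `a ∈ G`:
if `v ∈ V^K`, `v ≠ 0` and `T_a v = λ v` for ★ R1's `T_a v = e_K (ρ a v)` (`Representation.heckeRay`), then `‖λ‖ ≤ 1` — every `K`-invariant linear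
form sees through `e_K` (★ `Representation.apply_avgProj_eq_of_forall`), so §1 applies.  Unitary analogue of ★ `RayCoefficient.norm_sq_lt_of_eigenvector`
(square-integrable ⇒ `‖λ‖² < δ_P(a)`); with ★ R2's dictionary it bounds every exponent carried by a `K`-fixed ray eigenvector.
[cite: Casselman1995, §2.5, §4.1, Thm. 4.4.6] [cite: BushnellHenniart2006, §11.1] -/
theorem norm_heckeRay_eigenvalue_le_one (hu : ρ.IsUnitarizable) (hρ : ρ.IsSmooth) {K : Subgroup G} (hK : IsCompact (K : Set G))
    {a : G} {v : V} (hv : v ∈ ρ.fixedPoints K) (hv0 : v ≠ 0) {lam : ℂ} (hTv : ρ.heckeRay K a v = lam • v) :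
    ‖lam‖ ≤ 1 :=
  norm_le_one_of_isUnitarizable_of_eigenvector hu hv hv0 (T := ρ.heckeRay K a)
    (fun φ hφ => by rw [Representation.heckeRay_apply, Representation.apply_avgProj_eq_of_forall hK φ hφ (hρ _)]) hTv

/-- **Class level**: for a unitarizable class `c = [r]` (★ `IrrClass.IsUnitarizable`), every Hecke-ray eigenvalue of the representative `r` on a non-zero
`K`-fixed vector has modulus `≤ 1` (★ `IrrClass.IsUnitarizable.rep`, `r.isSmooth`). [cite: Casselman1995, §4.1] [cite: BushnellHenniart2006, §11.1] -/
theorem norm_heckeRay_eigenvalue_le_one_of_mk_eq {c : IrrClass G} (hc : c.IsUnitarizable) {r : SmoothIrrep G} (hr : IrrClass.mk r = c)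
    {K : Subgroup G} (hK : IsCompact (K : Set G)) {a : G} {v : r.V} (hv : v ∈ r.ρ.fixedPoints K) (hv0 : v ≠ 0) {lam : ℂ}
    (hTv : r.ρ.heckeRay K a v = lam • v) : ‖lam‖ ≤ 1 :=
  norm_heckeRay_eigenvalue_le_one (hc.rep hr) r.isSmooth hK hv hv0 hTv

end HeckeRay

/-! ## §3 (ED. 2) The EXPONENT currency: unitarizable ⇒ `‖δ_P(a)^{1/2} · χ′(a)‖ ≤ 1` for every Jacquet exponent `χ′` (over ★ R2)

ED. 2 (seat R90-C133-p01 (g3), after ★ p865257; ADDITIONS ONLY — §1–§2 byte-frozen, one import line added): the junction the consumer (N3) actually calls.  A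
Jacquet-module computation of a principal series produces EXPONENTS (★ `Representation.HasJacquetExponent ρ t χ′`: `χ′` is an eigencharacter of `M` on the normalised
Jacquet module with a non-zero eigenvector), not ray eigenvectors; ★ R2 `Representation.exists_hasEigenvalue_heckeRayEnd_of_hasJacquetExponent` turns an exponent into an
eigenvalue `δ_P(a)^{1/2} χ′(a)` (`rootDeltaChar t.P a · χ′ a`) of `T_a` on some `V^{K_n}` of an Iwahori datum, and §2 bounds it.  SANITY: the trivial representation
(unitary) has normalised exponent `δ_P^{-1/2}` and saturates the bound; Casselman's square-integrable bound is the strict `‖χ′(a)‖ < 1` (★ R4); for the excluded principal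
series `i_{U(Φ₂)}(‖·‖_E^{±1}μ⁻¹)` of S5-C :486 one exponent has `‖χ′(a)‖ = δ_P(a)^{-1} > δ_P(a)^{-1/2}` at a contracting `a` — the contradiction (N3) will draw. -/

section Exponent

variable {G V : Type*} [Group G] [TopologicalSpace G] [IsTopologicalGroup G] [AddCommGroup V] [Module ℂ V]
  {ρ : Representation ℂ G V}

/-- **Eigenvalue level**: for a smooth unitarizable `ρ` and compact `K`, every eigenvalue `c` of ★ R2's `T_a` AS AN ENDOMORPHISM of `V^K`
(`Representation.heckeRayEnd`) has `‖c‖ ≤ 1` (an eigenvector of `heckeRayEnd` is a non-zero `K`-fixed `heckeRay`-eigenvector, ★ `heckeRayEnd_apply_coe`; then §2).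
[cite: Casselman1995, §2.5, §4.1] [cite: BushnellHenniart2006, §11.1] -/
theorem norm_le_one_of_hasEigenvalue_heckeRayEnd (hu : ρ.IsUnitarizable) (hρ : ρ.IsSmooth) {K : Subgroup G} (hK : IsCompact (K : Set G))
    {a : G} {c : ℂ} (hc : Module.End.HasEigenvalue (ρ.heckeRayEnd hK hρ a) c) : ‖c‖ ≤ 1 := by
  obtain ⟨v, hv⟩ := hc.exists_hasEigenvector
  have hv0 : (v : V) ≠ 0 := fun h => hv.2 (Subtype.ext h)
  have hTv : ρ.heckeRay K a (v : V) = c • (v : V) := by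
    have h := congrArg Subtype.val hv.apply_eq_smul
    rwa [Representation.heckeRayEnd_apply_coe, Submodule.coe_smul] at h
  exact norm_heckeRay_eigenvalue_le_one hu hρ hK v.2 hv0 hTv

/-- **UNITARIZABLE ⇒ EVERY JACQUET EXPONENT IS BOUNDED BY `δ_P^{-1/2}` ALONG THE RAY.**  Let `t = (P, M, N)` be a parabolic triple with `N` closed and an
Iwahori datum `𝓘` (★ `ParabolicTriple.IwahoriDatum`: levels `K_n` with Iwahori factorisation, a dominant `a ∈ M`) satisfying ★ R2's three ray hypotheses
(`a` contracts `K_n ∩ N` into `K_n`, expands `K_n ∩ N̄` inside itself, and every `n ∈ N` is eventually conjugated into `K_n`), and let `ρ` be ADMISSIBLE and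
UNITARIZABLE.  Then every exponent `χ′` of `ρ` (★ `Representation.HasJacquetExponent ρ t χ′`, normalised Jacquet module) satisfies
`‖δ_P(a)^{1/2} · χ′(a)‖ ≤ 1`, i.e. `‖χ′(a)‖ ≤ δ_P(a)^{-1/2}` — ★ R2 `exists_hasEigenvalue_heckeRayEnd_of_hasJacquetExponent` + `norm_le_one_of_hasEigenvalue_heckeRayEnd`.
The unitary analogue of Casselman's square-integrability criterion (★ R4: `‖χ′(a)‖ < 1`); sharp at the trivial representation.
[cite: Casselman1995, §2.5, Prop. 4.1.4, Prop. 4.1.6, §4.4 p. 45, Thm. 4.4.6] [cite: BushnellHenniart2006, §11.1] -/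
theorem norm_rootDeltaChar_mul_exponent_le_one (t : ParabolicTriple G) [LocallyCompactSpace ↥t.P] (𝓘 : t.IwahoriDatum)
    (hN : IsClosed (t.N : Set G)) (hu : ρ.IsUnitarizable) (hρa : ρ.IsAdmissible)
    (haN : ∀ n, ∀ x ∈ 𝓘.K n ⊓ t.N, 𝓘.a * x * 𝓘.a⁻¹ ∈ 𝓘.K n)
    (haNbar : ∀ n, ∀ x ∈ 𝓘.K n ⊓ 𝓘.Nbar, 𝓘.a⁻¹ * x * 𝓘.a ∈ 𝓘.K n ⊓ 𝓘.Nbar)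
    (hexh : ∀ n, ∀ x ∈ t.N, ∃ m : ℕ, ∀ m', m ≤ m' → 𝓘.a ^ m' * x * (𝓘.a ^ m')⁻¹ ∈ 𝓘.K n)
    {χ' : ↥t.M →* ℂˣ} (hχ : ρ.HasJacquetExponent t χ') :
    ‖((rootDeltaChar t.P ⟨𝓘.a, t.M_le 𝓘.a_mem⟩ : ℂˣ) : ℂ) * ((χ' ⟨𝓘.a, 𝓘.a_mem⟩ : ℂˣ) : ℂ)‖ ≤ 1 := by
  obtain ⟨n, hn⟩ := Representation.exists_hasEigenvalue_heckeRayEnd_of_hasJacquetExponent t 𝓘 hN hρa haN haNbar hexh hχ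
  exact norm_le_one_of_hasEigenvalue_heckeRayEnd hu hρa.1 (𝓘.isCompact_K n) hn

/-- **The same as a bound on the exponent alone**: `‖χ′(a)‖ ≤ ‖δ_P(a)^{1/2}‖⁻¹` (`rootDeltaChar` takes values in `ℂˣ`, so its norm is non-zero).
[cite: Casselman1995, §4.4 p. 45, Thm. 4.4.6] -/
theorem norm_exponent_le_inv_norm_rootDeltaChar (t : ParabolicTriple G) [LocallyCompactSpace ↥t.P] (𝓘 : t.IwahoriDatum)
    (hN : IsClosed (t.N : Set G)) (hu : ρ.IsUnitarizable) (hρa : ρ.IsAdmissible)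
    (haN : ∀ n, ∀ x ∈ 𝓘.K n ⊓ t.N, 𝓘.a * x * 𝓘.a⁻¹ ∈ 𝓘.K n)
    (haNbar : ∀ n, ∀ x ∈ 𝓘.K n ⊓ 𝓘.Nbar, 𝓘.a⁻¹ * x * 𝓘.a ∈ 𝓘.K n ⊓ 𝓘.Nbar)
    (hexh : ∀ n, ∀ x ∈ t.N, ∃ m : ℕ, ∀ m', m ≤ m' → 𝓘.a ^ m' * x * (𝓘.a ^ m')⁻¹ ∈ 𝓘.K n)
    {χ' : ↥t.M →* ℂˣ} (hχ : ρ.HasJacquetExponent t χ') :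
    ‖((χ' ⟨𝓘.a, 𝓘.a_mem⟩ : ℂˣ) : ℂ)‖ ≤ ‖((rootDeltaChar t.P ⟨𝓘.a, t.M_le 𝓘.a_mem⟩ : ℂˣ) : ℂ)‖⁻¹ := by
  have h := norm_rootDeltaChar_mul_exponent_le_one t 𝓘 hN hu hρa haN haNbar hexh hχ
  have hd : 0 < ‖((rootDeltaChar t.P ⟨𝓘.a, t.M_le 𝓘.a_mem⟩ : ℂˣ) : ℂ)‖ := norm_pos_iff.2 (Units.ne_zero _)
  rw [norm_mul, mul_comm] at h
  rw [← one_div, le_div_iff₀ hd]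
  exact h

end Exponent

end Summit.HodgeConjecture.HodgeConjecture.R90.S5
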